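import Summits.BirchSwinnertonDyer.BirchSwinnertonDyer.Theorems.AdditiveKolyvaginRoadLevelSystemsBottom
import HarnessLib

/-!
# Route `AdditiveKolyvaginRoad`, crux `LevelKolyvaginSystemsAdditive` (item stmt-BirchSwinnertonDyer-21396, KS′):
# the rank-one bottom from a level Kolyvagin system and ONE-PRIME RAISING — the residual E-side input made minimal
# (cell `pub/bsd-wall`, lead prover `bsd-wall-akr-p2x` g0, line `birth`; `--supports stmt-BirchSwinnertonDyer-21396`, helper)

WHY. The sibling file `Theorems/AdditiveKolyvaginRoadLevelSystemsBottom.lean` proved: at a ♯ additive frame with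
`#Sel_p(E/K) = p`, a level Kolyvagin system `S` plus the TWO-PRIME jump (J2) give the conclusion of crux r2
`KolyvaginPrimitiveAdditive` (so the bottom crux BOT′ is carried by KS′). Here (J2) is cut down to its irreducible
E-side content: the ONE-PRIME RAISING (R) — the raising half of W. Zhang's Lemma 5.3 ∕ Prop. 5.4 (Gross–Parson) for the
canonical spaces `SelQP` at one new Bertolini–Darmon admissible prime, the exact companion of the LANDED lowering half
(A1) `stub_rankLoweringAdditive`:

  (R)  `q ∉ n` admissible, `v ∋ q`, `z` an `s`-eigenclass Kummer at `v` and NOT locally trivial at `v` (so `ε_q = s`), every class of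
       `Sel_n^s` locally trivial at `v`  ⟹  `dim Sel_{n∪{q}}^s = dim Sel_n^s + 1`.

Everything else is discharged in the kernel from LANDED inputs: (A1) produces `q₁` killing the generator `x` of
`Sel_∅^ε` (`Sel_{q₁}^ε = 0`, `Sel_{q₁}^{¬ε} = Sel_∅^{¬ε} = 0`, `x` not locally trivial above `q₁`); Čebotarev
(`exists_admQ_notMem_torsionLocalKer`) produces `q₂ ≠ q₁` detecting `x`; (Equiv) `localEquiv_of_admQ` with (9.2)
`loc_eq_zero_of_sign_ne_odd` fixes `ε_{q₂} = ε`, whence every `¬ε`-class is locally trivial above `q₂` and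
`Sel_{q₁q₂}^{¬ε} = Sel_{q₁}^{¬ε}` (§1, from the one-prime step `selQP_insert_inf_kummer_eq`); (R) gives
`dim Sel_{q₁q₂}^ε = 1`; the two-prime bottom `LevelKolyvaginSystemP.exists_kappa_empty_ne_zero_of_pair` and `realisation`
conclude. (R) is ONE relaxed admissible place in Poitou–Tate currency: `[relaxed : strict] = p` by the Lagrangian count
(`ZhangSupply.relIndex_sq_eq_of_selfdual`, `#H¹(K_q, E[p]) = p²`) and the relaxed line is the toric line by isotropy of
the symmetric local pairing — NOT YET IN THE TREE (binder `hraise`).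

CONTENTS. §1 `selQP_insert_eq_of_forall_mem_torsionLocalKer` (opposite eigenspace does not move),
`mem_selQP_insert_of_forall_mem_torsionLocalKer`. §2 `kolyvaginPrimitive_of_levelSystem_of_rankOne_of_raise`.

HONEST FRAMING: theorems only; 0 definitions, 0 named facts, 0 `sorry`; (R) is an explicit HYPOTHESIS; closes nothing.
CONSEQUENCE (planner's business): `KolyvaginPrimitiveAdditive ⇐ P ∧ KS′ ∧ (R)`, BOT′ 21397 not needed. BSD is not
proved by any of this.

References: [cite: WZhang2014, Thm. 4.3, Lemma 5.3, Prop. 5.4, Thm. 7.2, Lemma 7.3, §9 (9.2)–(9.3)]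
[cite: BertoliniDarmon2005, Lemma 2.6, Thm. 3.2] [cite: GrossLMS1991, §4 (4.4)].
-/

-- single-conjunct summit: `Summit.BirchSwinnertonDyer.BirchSwinnertonDyer.…` repeats the name by design
set_option linter.dupNamespace false

noncomputable section

open scoped Classical

namespace Summit.BirchSwinnertonDyer.BirchSwinnertonDyer.Theorems.AdditiveKoly

open WeierstrassCurve NumberField IsDedekindDomain
  Literature.NumberTheory.EllipticCurves Literature.NumberTheory.EllipticCurves.ModularForms
  Literature.NumberTheory.EllipticCurves.Rank1Residual Literature.NumberTheory.GaloisRepresentations Module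
  Summit.BirchSwinnertonDyer.Rank1Residual.X11b.Three.Koly

variable (W : WeierstrassCurve ℚ) (K : Type) [Field K] [NumberField K] (p : ℕ) [W.IsGloballyMinimal]
  (c : K ≃ₐ[ℚ] K) [Module (ZMod p) (Vp W K p)]

/-! ## §1 Sign-fixing at an admissible prime: the opposite eigenspace does not move -/

/-- **A class locally trivial above `q` passes between `Sel_n` and `Sel_{n∪{q}}` freely**: if every `μ`-eigenclass of
`H¹(K, E[p])` is locally trivial above the admissible `q ∉ n` (e.g. `μ ≠ ε_q`, W. Zhang (9.2)), then
`SelQP (insert q n) μ = SelQP n μ` (both E's Kummer condition and the toric condition above `q` hold for localisation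
zero; the one-prime step `selQP_insert_inf_kummer_eq`). [cite: WZhang2014, §9 (9.2)–(9.3), Prop. 5.4] -/
theorem selQP_insert_eq_of_forall_mem_torsionLocalKer (n : Finset (AdmQ W K p))
    (q : AdmQ W K p) (hqn : q ∉ n) (μ : Bool)
    (hkill : ∀ y : Vp W K p, conjAct W c ((p ^ 1 : ℕ) : ℤ) y = sgnP μ • y →
      ∀ v : HeightOneSpectrum (𝓞 K), ((q : ℕ) : 𝓞 K) ∈ v.asIdeal →
        y ∈ (W.baseChange K).torsionLocalKer (v.adicCompletion K) ((p ^ 1 : ℕ) : ℤ)) :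
    SelQP W K p c (insert q n) μ = SelQP W K p c n μ := by
  have hstep := selQP_insert_inf_kummer_eq W K p c n q hqn μ
  ext y
  constructor
  · intro hy
    have hK : y ∈ AddSubgroup.toZModSubmodule p
        (⨅ (v : HeightOneSpectrum (𝓞 K)) (_ : ((q : ℕ) : 𝓞 K) ∈ v.asIdeal),
          selmerLocalKer (W.baseChange K) (v.adicCompletion K) ((p ^ 1 : ℕ) : ℤ)) := by
      simp only [AddSubgroup.mem_toZModSubmodule, AddSubgroup.mem_iInf]
      exact fun v hv ↦ (W.baseChange K).torsionLocalKer_le_selmerLocalKer (v.adicCompletion K) _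
        (hkill y (conjAct_eq_of_mem_selQP W K p c _ μ hy) v hv)
    have h : y ∈ SelQP W K p c n μ ⊓ AddSubgroup.toZModSubmodule p
        (⨅ (v : HeightOneSpectrum (𝓞 K)) (_ : ((q : ℕ) : 𝓞 K) ∈ v.asIdeal),
          toricLocalKer (W.baseChange K) (v.adicCompletion K) ((p ^ 1 : ℕ) : ℤ)) := by
      rw [← hstep]
      exact Submodule.mem_inf.mpr ⟨hy, hK⟩
    exact (Submodule.mem_inf.mp h).1
  · intro hy
    have hT : y ∈ AddSubgroup.toZModSubmodule p
        (⨅ (v : HeightOneSpectrum (𝓞 K)) (_ : ((q : ℕ) : 𝓞 K) ∈ v.asIdeal),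
          toricLocalKer (W.baseChange K) (v.adicCompletion K) ((p ^ 1 : ℕ) : ℤ)) := by
      simp only [AddSubgroup.mem_toZModSubmodule, AddSubgroup.mem_iInf]
      exact fun v hv ↦ torsionLocalKer_le_toricLocalKer W K _ _
        (hkill y (conjAct_eq_of_mem_selQP W K p c _ μ hy) v hv)
    have h : y ∈ SelQP W K p c (insert q n) μ ⊓ AddSubgroup.toZModSubmodule p
        (⨅ (v : HeightOneSpectrum (𝓞 K)) (_ : ((q : ℕ) : 𝓞 K) ∈ v.asIdeal),
          selmerLocalKer (W.baseChange K) (v.adicCompletion K) ((p ^ 1 : ℕ) : ℤ)) := by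
      rw [hstep]
      exact Submodule.mem_inf.mpr ⟨hy, hT⟩
    exact (Submodule.mem_inf.mp h).1

/-- **A level-`n` class locally trivial above `q ∉ n` is a level-`(n ∪ {q})` class** (localisation zero is toric).
[cite: WZhang2014, §9 (9.3)] -/
theorem mem_selQP_insert_of_forall_mem_torsionLocalKer {n : Finset (AdmQ W K p)}
    {q : AdmQ W K p} (hqn : q ∉ n) {μ : Bool} {y : Vp W K p} (hy : y ∈ SelQP W K p c n μ)
    (hloc : ∀ v : HeightOneSpectrum (𝓞 K), ((q : ℕ) : 𝓞 K) ∈ v.asIdeal →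
      y ∈ (W.baseChange K).torsionLocalKer (v.adicCompletion K) ((p ^ 1 : ℕ) : ℤ)) :
    y ∈ SelQP W K p c (insert q n) μ := by
  have hT : y ∈ AddSubgroup.toZModSubmodule p
      (⨅ (v : HeightOneSpectrum (𝓞 K)) (_ : ((q : ℕ) : 𝓞 K) ∈ v.asIdeal),
        toricLocalKer (W.baseChange K) (v.adicCompletion K) ((p ^ 1 : ℕ) : ℤ)) := by
    simp only [AddSubgroup.mem_toZModSubmodule, AddSubgroup.mem_iInf]
    exact fun v hv ↦ torsionLocalKer_le_toricLocalKer W K _ _ (hloc v hv)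
  have h : y ∈ SelQP W K p c (insert q n) μ ⊓ AddSubgroup.toZModSubmodule p
      (⨅ (v : HeightOneSpectrum (𝓞 K)) (_ : ((q : ℕ) : 𝓞 K) ∈ v.asIdeal),
        selmerLocalKer (W.baseChange K) (v.adicCompletion K) ((p ^ 1 : ℕ) : ℤ)) := by
    rw [selQP_insert_inf_kummer_eq W K p c n q hqn μ]
    exact Submodule.mem_inf.mpr ⟨hy, hT⟩
  exact (Submodule.mem_inf.mp h).1

/-! ## §2 The bottom from a level system and ONE-PRIME RAISING (W. Zhang Lemma 5.3, raising half) -/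

section Raise

variable [W.IsElliptic] [NeZero (W.conductorNorm ℤ)] [Fact p.Prime]
  (Dt : ModularParametrizationData W (W.conductorNorm ℤ)) (β : ℤ) (ι : K →+* ℂ)

/-- **KOLYVAGIN PRIMITIVITY AT A RANK-ONE ♯ ADDITIVE FRAME FROM A LEVEL KOLYVAGIN SYSTEM, modulo ONE-PRIME RAISING (R).**
The binder `hraise` is the raising half of W. Zhang's Lemma 5.3 ∕ Prop. 5.4 for the canonical spaces at ONE new
Bertolini–Darmon admissible prime `q ∉ n` — the companion of the LANDED lowering half (A1) `stub_rankLoweringAdditive`: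
if the place `v ∋ q` SEES a non-zero FINITE (Kummer) localisation of some `s`-eigenclass `z` (so `ε_q = s`) and every class of `Sel_n^s`
is locally trivial at `v`, then `dim Sel_{n∪{q}}^s = dim Sel_n^s + 1` (Poitou–Tate at one relaxed admissible place:
`[relaxed : strict] = p` by the Lagrangian count `relIndex_sq_eq_of_selfdual`, and the relaxed line is the toric line
by isotropy; E-side, NOT YET IN THE TREE). GIVEN (R), at every ♯ additive frame with `c ≠ 1` and `#Sel_p(E/K) = p`,
every level Kolyvagin system yields `∃ n d, KolSupp n ∧ d.kolyvaginClass ≠ 0` — the conclusion of crux r2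
`KolyvaginPrimitiveAdditive`, WITHOUT the bottom crux BOT′. Assembly: `Sel_∅^ε = 𝔽_p x`, `Sel_∅^{¬ε} = 0`
(`finrank_selQP_empty_add_eq_one_iff`); (A1) kills `x` at some `q₁` (`Sel_{q₁}^ε = 0`, `Sel_{q₁}^{¬ε} = Sel_∅^{¬ε}`, `x`
not locally trivial above `q₁`); Čebotarev gives `q₂ ≠ q₁` detecting `x` at `v₂`, whence `ε_{q₂} = ε` by (Equiv)
`localEquiv_of_admQ` + (9.2) `loc_eq_zero_of_sign_ne_odd`, so `Sel_{q₁q₂}^{¬ε} = Sel_{q₁}^{¬ε} = 0` (§1); (R) at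
`(n, q, s, z, v) = ({q₁}, q₂, ε, x, v₂)` gives `dim Sel_{q₁q₂}^ε = 1`; then `exists_kappa_empty_ne_zero_of_pair` (sibling file `…LevelSystemsBottom`) and
`realisation`. [cite: WZhang2014, Thm. 4.3, Lemma 5.3, Prop. 5.4, Thm. 7.2, Lemma 7.3, §9 (9.2)] -/
theorem kolyvaginPrimitive_of_levelSystem_of_rankOne_of_raise (h5 : 5 ≤ p) (hadd : Addv W p)
    (hsurj : W.HasSurjectiveModNGaloisRep p)
    (hsp1 : ∀ (ℓ : ℕ) [Fact ℓ.Prime], W.HasMultiplicativeReductionAtPrime ℓ →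
      ¬ p ∣ padicValInt ℓ W.minimalDiscriminantInt)
    (hsp2 : ∃ (ℓ₁ ℓ₂ : ℕ) (_ : Fact ℓ₁.Prime) (_ : Fact ℓ₂.Prime), ℓ₁ ≠ ℓ₂ ∧
      W.HasMultiplicativeReductionAtPrime ℓ₁ ∧ W.HasMultiplicativeReductionAtPrime ℓ₂)
    (htam : ¬ p ∣ W.tamagawaProduct) (hr1 : W.analyticRank = 1)
    (hK : IsImaginaryQuadratic K) (hodd : Odd (NumberField.discr K))
    (hH : SatisfiesHeegnerHypothesis (W.conductorNorm ℤ) K)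
    (hL : (W.quadraticTwist (NumberField.discr K : ℚ)).entireLFunction 1 ≠ 0)
    (hβ : (4 * (W.conductorNorm ℤ : ℤ)) ∣ β ^ 2 - NumberField.discr K) (hc : ¬ (p : ℤ) ∣ Dt.c) (hc1 : c ≠ 1)
    -- (R) ONE-PRIME RAISING for the canonical spaces (W. Zhang Lemma 5.3, raising half; E-side, Poitou–Tate)
    (hraise : ∀ (n : Finset (AdmQ W K p)) (q : AdmQ W K p) (s : Bool) (z : Vp W K p)
      (v : HeightOneSpectrum (𝓞 K)), q ∉ n → ((q : ℕ) : 𝓞 K) ∈ v.asIdeal →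
      conjAct W c ((p ^ 1 : ℕ) : ℤ) z = sgnP s • z →
      z ∈ selmerLocalKer (W.baseChange K) (v.adicCompletion K) ((p ^ 1 : ℕ) : ℤ) →
      z ∉ (W.baseChange K).torsionLocalKer (v.adicCompletion K) ((p ^ 1 : ℕ) : ℤ) →
      (∀ y ∈ SelQP W K p c n s, y ∈ (W.baseChange K).torsionLocalKer (v.adicCompletion K) ((p ^ 1 : ℕ) : ℤ)) →
      finrank (ZMod p) (SelQP W K p c (insert q n) s) = finrank (ZMod p) (SelQP W K p c n s) + 1)
    (S : LevelKolyvaginSystemP W K p Dt β ι c)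
    (hsel : Nat.card (WeierstrassCurve.selmerGroup (W.baseChange K) (p : ℤ)) = p) :
    ∃ (n : ℕ) (d : KolyvaginHeegnerData Dt β ι n),
      KolyvaginDescent.KolSupp (Zhang2014.IsKolyvaginPrime (W.conductorNorm ℤ) W K p) n ∧
        d.kolyvaginClass (Fact.out : p.Prime) 1 ≠ 0 := by
  have hp : p.Prime := Fact.out
  have hp2 : p ≠ 2 := by omega
  have hcc : c * c = 1 := Method2.algEquiv_mul_self_eq_one K hK c
  -- total canonical dimension one at level `∅`; the sign `ε` carrying the line; a generator `x`
  have e1 : ((p ^ 1 : ℕ) : ℤ) = (p : ℤ) := by simp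
  have hsel' : Nat.card (selmerGroup (W.baseChange K) ((p ^ 1 : ℕ) : ℤ)) = p := by rw [e1]; exact hsel
  have hone : finrank (ZMod p) (SelQP W K p c ∅ true) + finrank (ZMod p) (SelQP W K p c ∅ false) = 1 :=
    (finrank_selQP_empty_add_eq_one_iff W K p hp2 hK c hcc).mpr hsel'
  obtain ⟨ε, hε1, hε0⟩ : ∃ ε : Bool, finrank (ZMod p) (SelQP W K p c ∅ ε) = 1 ∧
      finrank (ZMod p) (SelQP W K p c ∅ (!ε)) = 0 := by
    rcases Nat.eq_zero_or_pos (finrank (ZMod p) (SelQP W K p c ∅ true)) with h | h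
    · refine ⟨false, ?_, ?_⟩
      · omega
      · change finrank (ZMod p) (SelQP W K p c ∅ true) = 0
        exact h
    · refine ⟨true, ?_, ?_⟩
      · omega
      · change finrank (ZMod p) (SelQP W K p c ∅ false) = 0
        omega
  haveI := finiteDimensional_selQP W K p c ∅ (!ε)
  have hbot : SelQP W K p c ∅ (!ε) = ⊥ := Submodule.finrank_eq_zero.mp hε0
  obtain ⟨⟨x, hxmem⟩, hx0, hgen⟩ := finrank_eq_one_iff'.mp hε1
  have hx0' : x ≠ 0 := fun h ↦ hx0 (Subtype.ext h)
  have hline : ∀ y ∈ SelQP W K p c ∅ ε, ∃ a : ZMod p, y = a • x := by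
    intro y hy
    obtain ⟨a, ha⟩ := hgen ⟨y, hy⟩
    exact ⟨a, by simpa using congrArg Subtype.val ha.symm⟩
  have hxsgn : conjAct W c ((p ^ 1 : ℕ) : ℤ) x = sgnP ε • x := conjAct_eq_of_mem_selQP W K p c ∅ ε hxmem
  -- (A1), LANDED: an admissible `q₁` killing `x`
  obtain ⟨q₁, -, hxq₁, -, hfr₁, hfix₁⟩ := stub_rankLoweringAdditive W p K Dt β ι h5 hadd hsurj hsp1 hsp2 htam hr1
    hK hodd hH hL hβ hc c hc1 ∅ ε x hxmem hx0'
  have hfr₁' : finrank (ZMod p) (SelQP W K p c (insert q₁ ∅) ε) = 0 := by omega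
  haveI := finiteDimensional_selQP W K p c (insert q₁ ∅) ε
  have hbot₁ : SelQP W K p c (insert q₁ ∅) ε = ⊥ := Submodule.finrank_eq_zero.mp hfr₁'
  -- `x` is not locally trivial above `q₁` (else it would survive at level `{q₁}`)
  obtain ⟨v₁, hv₁, hdet₁⟩ : ∃ v₁ : HeightOneSpectrum (𝓞 K), ((q₁ : ℕ) : 𝓞 K) ∈ v₁.asIdeal ∧
      x ∉ (W.baseChange K).torsionLocalKer (v₁.adicCompletion K) ((p ^ 1 : ℕ) : ℤ) := by
    by_contra hall
    push Not at hall
    exact hxq₁ (mem_selQP_insert_of_forall_mem_torsionLocalKer W K p c (Finset.notMem_empty _) hxmem hall)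
  -- Čebotarev, LANDED: a second admissible `q₂ ≠ q₁` detecting `x` at `v₂`
  obtain ⟨q₂, hq₂, v₂, hv₂, hdet₂⟩ :=
    exists_admQ_notMem_torsionLocalKer W K p c h5 hadd hsurj hK hH hc1 hxmem hx0' {q₁}
  have hne : q₁ ≠ q₂ := by
    rintro rfl
    exact hq₂ (Finset.mem_singleton_self _)
  have hq₂' : q₂ ∉ insert q₁ (∅ : Finset (AdmQ W K p)) := by simpa using fun h ↦ hne h.symm
  -- (Equiv) + (9.2): the sign of `q₂` is `ε`, so every `¬ε`-eigenclass is locally trivial above `q₂`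
  set loc₂ := (W.baseChange K).torsionLocMap (v₂.adicCompletion K) ((p ^ 1 : ℕ) : ℤ) with hloc₂
  have hNodd : Odd (((p ^ 1 : ℕ) : ℤ)) := by
    rw [pow_one]
    exact_mod_cast hp.odd_of_ne_two hp2
  have hNloc : ∀ (v : HeightOneSpectrum (𝓞 K)) (z : Vp W K p),
      ((p ^ 1 : ℕ) : ℤ) • (W.baseChange K).torsionLocMap (v.adicCompletion K) ((p ^ 1 : ℕ) : ℤ) z = 0 :=
    fun v z ↦ zsmul_discreteH1_torsion ((p ^ 1 : ℕ) : ℤ) _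
  obtain ⟨s, hs⟩ := localEquiv_of_admQ W K p hK.1 hc1 q₂
  have hsε : s = ε := by
    by_contra hsne
    exact hdet₂ (loc_eq_zero_of_sign_ne_odd (conjAct W c _) loc₂ (hs v₂ hv₂) hxsgn hsne hNodd (hNloc v₂ x))
  have hkill : ∀ y : Vp W K p, conjAct W c ((p ^ 1 : ℕ) : ℤ) y = sgnP (!ε) • y →
      ∀ v : HeightOneSpectrum (𝓞 K), ((q₂ : ℕ) : 𝓞 K) ∈ v.asIdeal →
        y ∈ (W.baseChange K).torsionLocalKer (v.adicCompletion K) ((p ^ 1 : ℕ) : ℤ) := by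
    intro y hy v hv
    have hne' : s ≠ !ε := by rw [hsε]; cases ε <;> decide
    exact loc_eq_zero_of_sign_ne_odd (conjAct W c _)
      ((W.baseChange K).torsionLocMap (v.adicCompletion K) ((p ^ 1 : ℕ) : ℤ)) (hs v hv) hy hne' hNodd (hNloc v y)
  have hfix₂ : SelQP W K p c (insert q₂ (insert q₁ ∅)) (!ε) = SelQP W K p c (insert q₁ ∅) (!ε) :=
    selQP_insert_eq_of_forall_mem_torsionLocalKer W K p c (insert q₁ ∅) q₂ hq₂' (!ε) hkill
  -- (R): the `ε`-part jumps to dimension one at the level `{q₁, q₂}`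
  have hR : finrank (ZMod p) (SelQP W K p c (insert q₂ (insert q₁ ∅)) ε) = 1 := by
    have hxK₂ : x ∈ selmerLocalKer (W.baseChange K) (v₂.adicCompletion K) ((p ^ 1 : ℕ) : ℤ) :=
      ((mem_selQP_iff W K p c ∅ ε x).mp hxmem).2.2.1 v₂ (fun q hq ↦ absurd hq (Finset.notMem_empty q))
    rw [hraise (insert q₁ ∅) q₂ ε x v₂ hq₂' hv₂ hxsgn hxK₂ hdet₂ (fun y hy ↦ by
      rw [hbot₁] at hy
      rw [(Submodule.mem_bot (R := ZMod p)).mp hy]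
      exact zero_mem _), hfr₁']
  -- total canonical dimension one at `{q₁, q₂}`
  have hL : insert q₂ (insert q₁ (∅ : Finset (AdmQ W K p))) = {q₁, q₂} := Finset.pair_comm q₂ q₁
  have hrank : finrank (ZMod p) (SelQP W K p c {q₁, q₂} true) +
      finrank (ZMod p) (SelQP W K p c {q₁, q₂} false) = 1 := by
    have h0 : finrank (ZMod p) (SelQP W K p c (insert q₂ (insert q₁ ∅)) (!ε)) = 0 := by rw [hfix₂, hfix₁, hε0]
    rw [hL] at hR h0
    cases ε
    · change finrank (ZMod p) (SelQP W K p c {q₁, q₂} true) = 0 at h0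
      omega
    · change finrank (ZMod p) (SelQP W K p c {q₁, q₂} false) = 0 at h0
      omega
  -- the two-prime bottom (§2), then `realisation`
  obtain ⟨m, hm⟩ := S.exists_kappa_empty_ne_zero_of_pair W K p c Dt β ι hline hbot hne hv₁ hdet₁ hrank
  exact S.exists_kolyvaginClass_ne_zero W K p Dt β ι c hm

end Raise

end Summit.BirchSwinnertonDyer.BirchSwinnertonDyer.Theorems.AdditiveKoly

end
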